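import Summits.MatrixMultiplication.OmegaCensus.SmallFormats.MatMul22nRankGF7PatternParts1
import Summits.MatrixMultiplication.OmegaCensus.SmallFormats.MatMul22nRankGF7PatternParts2
import Summits.MatrixMultiplication.OmegaCensus.SmallFormats.MatMul22nRankGF7PatternParts3
import Summits.MatrixMultiplication.OmegaCensus.SmallFormats.MatMul22nRankGF7PatternParts4
import Summits.MatrixMultiplication.OmegaCensus.SmallFormats.MatMul22nRankGF7PatternParts5
import HarnessLib

/-!
# ω-census family (a): every normalised slack-4 column pattern is listed — assembly of the kernel replay

Cell `pub-omega` (unit `pub-omega-tensor-g15`), topic `Summits/MatrixMultiplication/OmegaCensus` (sub-folder `SmallFormats`).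
Framing (verbatim): lottery ticket; floor = certified bounds/negative ranges. HONEST FRAMING: machine-generated data / kernel replays
(`pub-omega-tensor-g15/code/gen_patternparts.py`) for step P1 of `pub-omega-tensor-g15/KERNEL-S4-DESIGN.md`; nothing here is progress on `ω`.
`normList7_complete`: every normalised slack-4 pattern (`IsPat7 4`, `IsNorm7`) is pointwise one of the 841 listed ones;
`norm_pattern_rep7`: hence it is a class representative `repVal7 c` (`c < 120`) composed with the action of a generator word on `Ω`.
-/

namespace Summit.MatrixMultiplication.OmegaCensus.SmallFormats

set_option maxRecDepth 100000 in
/-- The part lists together are `allStates7`. -/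
theorem allStates7_eq : allStates7 = G7_1 ++ G7_2 ++ G7_3 ++ G7_4 ++ G7_5 := by decide +kernel

/-- The search succeeds from every listed depth-9 state. -/
theorem allStates7_ok : (allStates7.all fun A => dfs7m 4 normMem7 42 9 A) = true := by
  rw [allStates7_eq]
  simp only [List.all_append, G7_1_ok, G7_2_ok, G7_3_ok, G7_4_ok, G7_5_ok, Bool.and_self]

/-- **Every normalised slack-4 pattern is listed.** -/
theorem normList7_complete {P : ℕ → ℕ} (hP : IsPat7 4 P) (hN : IsNorm7 P) : ∃ n < 841, ∀ z < 42, P z = normVal7 n z := by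
  have hall : ∀ A ∈ reach7 4 9 10 0 0, dfs7m 4 normMem7 42 9 A = true := by
    intro A hA
    have hc : A ∈ allStates7 := List.elem_iff.1 (List.all_eq_true.1 reach_cover7 A hA)
    exact List.all_eq_true.1 allStates7_ok A hc
  have hm := cover7_sound (s := 4) (by norm_num) (by norm_num) (by norm_num) hall hP hN
  obtain ⟨n, hn, hpk⟩ := normMem7_sound hm
  refine ⟨n, hn, fun z hz => ?_⟩
  have hf := fld_packP7 (s := 4) (by norm_num) hP.1 hz
  unfold normVal7
  rw [hpk, hf]
  simp

/-- **Every normalised slack-4 pattern is a class representative moved by `PGL₂(7)`.** -/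
theorem norm_pattern_rep7 {P : ℕ → ℕ} (hP : IsPat7 4 P) (hN : IsNorm7 P) :
    ∃ c < 120, ∃ w : List ℕ, (∀ k ∈ w, k < 2) ∧ ∀ z < 42, P z = repVal7 c (lmulOmW7 w z) := by
  obtain ⟨n, hn, hPn⟩ := normList7_complete hP hN
  obtain ⟨hc, hw, hval⟩ := normCert7_ok ⟨n, hn⟩
  exact ⟨normCls7 n, hc, normWord7 n, hw, fun z hz => by rw [hPn z hz]; exact hval ⟨z, hz⟩⟩

end Summit.MatrixMultiplication.OmegaCensus.SmallFormats
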